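import Literature.AlgebraicGeometry.HodgeTheory.MotivatedClasses
import Literature.AlgebraicGeometry.HodgeTheory.HodgeConjecture
import Literature.AlgebraicGeometry.HodgeTheory.IsoTransport
import Literature.AlgebraicGeometry.HilbertScheme.HilbertSchemeOfPoints
import Literature.AlgebraicGeometry.Motives.MotivatedPeriodTorsor
import HarnessLib

/-!
# Varieties cohomologically dominated by the powers of another variety ("`Y` is motivated by `X`", Arapura 2006) and the inheritance of the Hodge conjecture (Arapura 2006, Lemma 4.2; Hilbert schemes of points: de Cataldo–Migliorini 2002, Thm. 6.2.1) — DEFINITION + NAMED FACTS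

Layer `Literature/AlgebraicGeometry/HodgeTheory`.  Written for the Hodge-ladder stage-4 scoping
(run/shared/lean/pub/hodge-director/STAGE4-ABELIAN-MOTIVIC-TYPE.md, v4 §0-bis "the STRICT sense of
abelian motivic type"): the mechanism by which a variety inherits the Hodge conjecture from the Hodge
conjecture for the powers of ANOTHER variety with NOTHING ELSE (no standard conjecture `B`, no
Kuga–Satake input) — as opposed to André's WEAK motivation (`M(X) ∈ M(Ab)`), which only yields "Hodge
⟹ motivated" (file `Hyperkaehler/HodgeClassesMotivated`, André 1996 Thm. 0.6.2 / §6.3).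

## Sources (read: arXiv texts `paper:arxiv-math_0501348`, `paper:arxiv-math_0005249`,
`paper:arxiv-1506.04297`, `paper:arxiv-1009.0413`, `paper:arxiv-1904.11320`)

* D. Arapura, *Motivation for Hodge cycles*, Adv. Math. 207 (2006) 762–781 [Arapura2006].
  Introduction: "Given two smooth projective varieties `X` and `Y` over a field, we say that `X`
  motivates `Y` or that `Y` is motivated by `X` if the motive of `Y` is contained in the category
  generated from `X` by taking sums, summands and products. […] if the Hodge (generalized Hodge,
  Lefschetz standard...) conjecture holds for `X` and all its powers, then it holds for any variety
  motivated by it. For the precise statement we can use homological motives, however, we find it more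
  convenient to use the construction of motives due to André".  §1: "`Y` is motivated by `𝒱` (or a
  smooth projective variety `X`) if `[Y]` lies in `M_A(𝒱)` (or `M_A(X)`) […] Replacing `M_A(𝒱)` by
  `M_A(𝒱)^full` leads to the more flexible […] notion of weak motivation. For example, André has shown
  that any K3 surface is weakly motivated by an Abelian variety. The corresponding result for
  motivation is unknown except in special cases such as for Kummer surfaces."  **Lemma 1.1**: "Given
  `X, Y` in `SPVar_k`, `Y` is (weakly) motivated by `X` if and only if there exists a morphism
  `f : ⊕_{m,n} [X]^{⊗n}(m) → [Y]` in `M_A(X)` (`M_A(X)^full`) inducing a surjection on cohomology."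
  **Lemma 4.2**: "Suppose that `X` and `Y` are smooth projective varieties such that `Y` is motivated
  by `X`. If `X` and all its powers satisfies one of the conjectures (`D`, `B`, `HC`, `GHC`) stated
  above, then the same conjecture holds for `Y` and all its powers. If `Y` is weakly motivated by `X`
  and `AC` holds for all powers of `X`, then it holds for all powers of `Y`."  **Corollary 4.4**: "If
  `X` is weakly motivated by an Abelian variety, then `AC` holds for `X` and all its powers."
  **Theorem 7.4** (Cataldo-Migliorini): "`M` is motivated by `X`" (`X` a smooth projective surface,
  `M = X^{[n]}` the Hilbert scheme of zero dimensional subschemes of fixed length `n`, "smooth and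
  projective", Fogarty).  **Corollary 7.6**: "If `X` is an Abelian surface over `ℂ`, the Hodge conjecture
  holds for `M`."  (Section numbering of the published version confirmed against Charles–Markman,
  Compositio 149 (2013) §1: "[Arapura], Corollaries 4.3, 7.2 and 7.5", "Corollary 7.9", and against
  Xu 2018 Thm. 3.1: "([Ar06], Lemma 4.2)".)
* M. A. de Cataldo, L. Migliorini, *The Chow groups and the motive of the Hilbert scheme of points on
  a surface*, J. Algebra 251 (2002) 824–848 [DecataldoMigliorini2002], **Theorem 6.2.1**: "Let `X` be
  an irreducible nonsingular projective surface defined over an algebraically closed field. There is a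
  natural isomorphism of effective Chow motives with rational coefficients
  `(X^{[n]}, Δ_{X^{[n]}}) ≃ ⊕_{ν ∈ 𝔓(n)} (X^{(ν)}, Δ_{X^{(ν)}})(n - l(ν))`" — realised by the
  correspondences `Γ̂^ν = Γ^ν/𝔖_ν` (§2, §6.2: "The correspondence `Γ̂^ν` defines a morphism […] of
  effective Chow motives […] This morphism admits […] a right inverse"); **Remark 6.2.3**: "Over the
  complex numbers, Theorem 6.2.1 gives immediately the structure of the singular cohomology
  `H^*(X^{[n]}, ℚ)`, together with its Hodge structure."
* Z. Xu, *Algebraic cycles on a generalized Kummer variety*, Int. Math. Res. Not. IMRN 2018, no. 3,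
  932–948 [Xu2018Kummer], §3.1 (the same definitions, "`Y` is said to be motivated by `X` if the André
  motive of `Y` is isomorphic in `𝓜_A` to an object in `𝓜_A(⟨X⟩)`"), Theorem 3.1 = [Ar06] Lemma 4.2.
* A. Soldatenkov, IMRN 2022 (arXiv:1904.11320) §4.1 (restates [DM1]: "`𝐌(S^{[n]}) ≃ ⊕_ν 𝐌(S^{(ν)})(n - l(ν))`,
  which actually holds on the level of Chow motives […] The motive of `S^{(ν)}` is by definition a
  submotive of `⊗_i 𝐌(S^{ν_i})`").

## Rendering on the tree's real carriers (what a reviewer must accept)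

The tree has no category of (André / homological / Chow) motives on the real carriers; it has the
real-carrier notion "`T : Hᵃ(X(ℂ); ℂ) → Hᵇ(W(ℂ); ℂ)` is induced by an algebraic correspondence"
(`HodgeTheory.IsAlgebraicCorrespondence m n W X T`, file `MotivatedClasses`: `T = γ^*`,
`γ ∈ Nᵉ H^{2e}((W ⊗ X)(ℂ); ℂ)` algebraic, any degrees `a + 2e = b + 2 dim X` — which is how the Tate
twists `[X]^{⊗n}(m)` act on cohomology), the cartesian powers `X.pow e` (`Motives.SchemeOver.pow`,
dimension `e * dim X`, `Motives.IsSmoothProjective.pow`) and `HodgeConjectureFor d X`.  We therefore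
record Arapura's criterion Lemma 1.1 with ALGEBRAIC (rather than motivated-modelled-on-`⟨X⟩`)
correspondences:

* `IsDominatedByPowers dY Y dX X` — **every `Hᵏ(Y(ℂ); ℂ)` is the `ℂ`-span of the images of
  algebraic correspondences `Hᵃ(Xᵉ(ℂ); ℂ) → Hᵏ(Y(ℂ); ℂ)` from cartesian powers `Xᵉ` of `X`**
  (`e = 0`, `X⁰ = Spec ℂ`, contributes the algebraic classes of `Y`).  Algebraic correspondences are
  motivated correspondences modelled on any admissible class (André 1996 §2.1 "il est clair que
  `A_mot(X)_E` contient `A(X)`"), so by Lemma 1.1 (⇐) a variety dominated in this sense IS "motivated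
  by `X`" in Arapura's (strong) sense; the predicate is thus STRONGER than the printed hypothesis, and
  every fact below whose hypothesis is `IsDominatedByPowers` is implied by the printed statement.
  (Finiteness of the family of correspondences is automatic: `Hᵏ(Y(ℂ); ℂ)` is finite-dimensional for
  `Y` smooth projective.)
* Powers: "`X` and all its powers" is rendered `∀ m, HodgeConjectureFor ((m + 1) * dX) (X.pow (m + 1))`
  — the positive cartesian powers `X¹ = Spec ℂ ⊗ X ≅ X`, `X²`, … (`HodgeConjectureFor` is invariant
  under isomorphism: `hodgeConjectureFor_iff_of_iso'` below, from the tree's `IsoTransport`); the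
  zeroth power (a point) is never meant in print and is left out.  Conclusions additionally carry the
  plain conjunct `HodgeConjectureFor dY Y` ("for `Y`"), so that users need no transport.

## Content

* `IsDominatedByPowers` (definition) + `isDominatedByPowers_iff`, `IsDominatedByPowers.of_range_eq_top`.
* `hodgeConjectureFor_iff_of_iso'` — iso-invariance of `HodgeConjectureFor` (both conjuncts; proved,
  from `IsoTransport`).
* NAMED FACT `Arapura2006_hodgeClasses_algebraic_of_isDominatedByPowers` — Lemma 4.2 (`HC` clause) with the
  hypothesis of Lemma 1.1 in algebraic form.
* NAMED FACT `DecataldoMigliorini2002_hilbertScheme_isDominatedByPowers` — Thm. 6.2.1 (with Rem. 6.2.3)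
  / Arapura Thm. 7.4: the Hilbert scheme of `n` points of a smooth projective complex surface is
  dominated by the powers of the surface.
* Derived (kernel, modulo the two facts): `hodgeConjectureFor_hilbertScheme_of_surfacePowers` — the
  Hodge conjecture for `S^{[n]}` and all its powers from the Hodge conjecture for all powers of `S`
  (Arapura's Cor. 7.6 is the abelian-surface instance of exactly this inference).

## What is NOT here

André/homological motives as categories; the clauses `D`, `B`, `GHC`, `AC` of Lemma 4.2; weak
motivation (that is `Hyperkaehler/HodgeClassesMotivated` + `MotivatedClasses`); the Hodge conjecture
for powers of abelian surfaces (Arapura Cor. 6.5 / Ramón Marí 2008 — an instance of the summit's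
`HC_AV`, not vendored); any proof of the two facts.
-/

noncomputable section

open CategoryTheory MonoidalCategory
open Literature.AlgebraicGeometry.HilbertScheme (IsHilbertSchemeOfPoints)

namespace Literature.AlgebraicGeometry.HodgeTheory

open Literature.AlgebraicGeometry.Motives (SchemeOver IsSmoothProjective)

/-! ### Iso-invariance of `HodgeConjectureFor` (bookkeeping; from `IsoTransport`) -/

/-- `HodgeConjectureFor n` is invariant under isomorphisms of `ℂ`-schemes: Hodge models transport
(`nonempty_hodgeModel_iff_of_iso`) and so does the cycle statement
(`forall_hodgeClass_mem_algebraicClasses_iff_of_iso`) — transport of structure along `e(ℂ)`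
composed with the analytification (Serre, GAGA §2; Grothendieck).  (The same three lines exist
summit-side as `Ring2.Hypotheses.hodgeConjectureFor_iff_of_iso`; Literature cannot import it.)
[cite: SerreGAGA1956, §2] [cite: GrothendieckTopology1969, §1] -/
theorem hodgeConjectureFor_iff_of_iso' {n : ℕ} {X' X : SchemeOver ℂ} (e : X' ≅ X) :
    HodgeConjectureFor n X' ↔ HodgeConjectureFor n X := by
  rw [hodgeConjectureFor_iff, hodgeConjectureFor_iff]
  exact and_congr (nonempty_hodgeModel_iff_of_iso e)
    (forall_congr' fun p ↦ forall_hodgeClass_mem_algebraicClasses_iff_of_iso e p)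

/-- The first cartesian power `X¹ = Spec ℂ ⊗ X` is isomorphic to `X` (left unitor). [folklore] -/
def powOneIso (X : SchemeOver ℂ) : X.pow 1 ≅ X :=
  λ_ X

/-- Hence `HodgeConjectureFor n (X.pow 1) ↔ HodgeConjectureFor n X` (transport along the left
unitor `Spec ℂ ⊗ X ≅ X`). [cite: SerreGAGA1956, §2] [cite: GrothendieckTopology1969, §1] -/
theorem hodgeConjectureFor_pow_one_iff {n : ℕ} (X : SchemeOver ℂ) :
    HodgeConjectureFor n (X.pow 1) ↔ HodgeConjectureFor n X :=
  hodgeConjectureFor_iff_of_iso' (powOneIso X)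

/-! ### Cohomological domination by the powers of a variety (Arapura 2006, Lemma 1.1, algebraic form) -/

section Dominated

/-- **`Y` (of dimension `dY`) is cohomologically dominated by the cartesian powers of `X` (of
dimension `dX`) through algebraic correspondences**: for every degree `k`, `Hᵏ(Y(ℂ); ℂ)` is the
`ℂ`-span of the classes lying in the image of some linear map `T : Hᵃ(Xᵉ(ℂ); ℂ) → Hᵏ(Y(ℂ); ℂ)`
INDUCED BY AN ALGEBRAIC CYCLE on `Y × Xᵉ` (`IsAlgebraicCorrespondence dY (e * dX) Y (X.pow e) T`; any
`e ≥ 0` and any source degree `a`, i.e. any Tate twist).  This is the criterion of Arapura 2006,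
Lemma 1.1 for "`Y` is motivated by `X`" ("there exists a morphism `f : ⊕_{m,n} [X]^{⊗n}(m) → [Y]` in
`M_A(X)` inducing a surjection on cohomology") with the morphism required to be given by ALGEBRAIC
correspondences — a sufficient condition for motivation in Arapura's strong sense (module docstring),
and the form in which the instances in print arise (Chow-motivic decompositions: de Cataldo–Migliorini
2002 Thm. 6.2.1 for `X^{[n]}`, Xu 2018 Thm. 1.1 for generalized Kummer varieties).  A definition;
nothing is asserted. [cite: Arapura2006, §1 Lemma 1.1 and Introduction (p. 762)] -/
def IsDominatedByPowers (dY : ℕ) (Y : SchemeOver ℂ) (dX : ℕ) (X : SchemeOver ℂ) : Prop :=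
  ∀ k : ℕ,
    Submodule.span ℂ
        {c : complexBetti Y k |
          ∃ (e a : ℕ) (T : complexBetti (X.pow e) a →ₗ[ℂ] complexBetti Y k),
            IsAlgebraicCorrespondence dY (e * dX) Y (X.pow e) T ∧ c ∈ LinearMap.range T} = ⊤

variable {dY : ℕ} {Y : SchemeOver ℂ} {dX : ℕ} {X : SchemeOver ℂ}

/-- Unfolding lemma. [cite: Arapura2006, §1 Lemma 1.1] -/
theorem isDominatedByPowers_iff : IsDominatedByPowers dY Y dX X ↔
    ∀ k : ℕ,
      Submodule.span ℂ
          {c : complexBetti Y k |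
            ∃ (e a : ℕ) (T : complexBetti (X.pow e) a →ₗ[ℂ] complexBetti Y k),
              IsAlgebraicCorrespondence dY (e * dX) Y (X.pow e) T ∧ c ∈ LinearMap.range T} = ⊤ :=
  Iff.rfl

/-- A sufficient condition (Arapura's Cor. 1.2 shape "a surjective morphism `Xⁿ → Y`"): if in every
degree `k` a SINGLE algebraic correspondence from some power `Xᵉ` is surjective onto `Hᵏ(Y(ℂ); ℂ)`,
then `Y` is dominated by the powers of `X`. [cite: Arapura2006, §1 Cor. 1.2] -/
theorem IsDominatedByPowers.of_range_eq_top
    (h : ∀ k : ℕ, ∃ (e a : ℕ) (T : complexBetti (X.pow e) a →ₗ[ℂ] complexBetti Y k),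
      IsAlgebraicCorrespondence dY (e * dX) Y (X.pow e) T ∧ LinearMap.range T = ⊤) :
    IsDominatedByPowers dY Y dX X := by
  intro k
  obtain ⟨e, a, T, hT, hsurj⟩ := h k
  refine eq_top_iff.mpr fun c _ ↦ Submodule.subset_span ⟨e, a, T, hT, ?_⟩
  rw [hsurj]
  exact Submodule.mem_top

end Dominated

/-! ### Named facts (D-0014): Arapura 2006 Lemma 4.2; de Cataldo–Migliorini 2002 Thm. 6.2.1 -/

section Facts

/-- **Arapura 2006, Lemma 4.2 (its clause on Hodge classes), with the motivation hypothesis in the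
algebraic form of Lemma 1.1 — a variety dominated by the powers of `X` inherits the algebraicity of its
Hodge classes from the powers of `X`** (printed sentence, with the paper's name for the statement, in
the module docstring: "Suppose that `X` and `Y` are smooth projective varieties such that `Y` is
motivated by `X`. If `X` and all its powers satisfies [every rational Hodge class is algebraic], then the
same holds for `Y` and all its powers.").  Rendering (module docstring): for `X` smooth projective of
dimension `dX` and `Y` smooth projective of dimension `dY` over `ℂ` with `IsDominatedByPowers dY Y dX X`
(which implies "`Y` is motivated by `X`" by Lemma 1.1), the tree's per-variety Hodge statement for all
positive cartesian powers `X^{m+1}` (dimension `(m + 1) * dX`) implies the same statement for `Y` and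
for all positive cartesian powers `Y^{m+1}`.  A THEOREM in print (status: proved; unproved in the
tree). [cite: Arapura2006, Lemma 4.2 and Lemma 1.1 (§4, §1)] -/
def Arapura2006_hodgeClasses_algebraic_of_isDominatedByPowers : Prop :=
  ∀ ⦃dX : ℕ⦄ ⦃X : SchemeOver ℂ⦄ ⦃dY : ℕ⦄ ⦃Y : SchemeOver ℂ⦄,
    IsSmoothProjective dX X → IsSmoothProjective dY Y → IsDominatedByPowers dY Y dX X →
      (∀ m : ℕ, HodgeConjectureFor ((m + 1) * dX) (X.pow (m + 1))) →
        HodgeConjectureFor dY Y ∧ ∀ m : ℕ, HodgeConjectureFor ((m + 1) * dY) (Y.pow (m + 1))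

/-- **de Cataldo–Migliorini 2002, Thm. 6.2.1 (with Rem. 6.2.3) / Arapura 2006, Thm. 7.4 — the Hilbert
scheme of points of a smooth projective complex surface is dominated by the powers of the surface.**
Printed (dCM): "Let `X` be an irreducible nonsingular projective surface defined over an algebraically
closed field. There is a natural isomorphism of effective Chow motives with rational coefficients
`(X^{[n]}, Δ_{X^{[n]}}) ≃ ⊕_{ν ∈ 𝔓(n)} (X^{(ν)}, Δ_{X^{(ν)}})(n - l(ν))`", realised by the algebraic
correspondences `Γ̂^ν = Γ^ν/𝔖_ν` (`Γ^ν` a cycle on `X^{l(ν)} × X^{[n]}`), and "Over the complex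
numbers, Theorem 6.2.1 gives immediately the structure of the singular cohomology `H^*(X^{[n]}, ℚ)`";
Arapura Thm. 7.4: "`M` [`= X^{[n]}`] is motivated by `X`".  Rendering: for `S` smooth projective of
dimension `2` over `ℂ` (geometrically irreducible, as in the tree's `IsSmoothProjective`) and `(H, Ξ)` a
Hilbert scheme of `n` points of `S` over `ℂ` (`IsHilbertSchemeOfPoints n S H Ξ`) which is smooth
projective of dimension `2n` (Fogarty — a theorem about the witness, taken as a clause as in
`Hyperkaehler.IsOfK3HilbertType`), every `Hᵏ(H(ℂ); ℂ)` is spanned by the images of algebraic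
correspondences from the powers `S^{l(ν)}` (the `Γ^ν` composed with the quotients
`S^{l(ν)} → S^{(ν)}`, whose push-forwards are surjective on rational cohomology), i.e.
`IsDominatedByPowers (2 * n) H 2 S`.  A THEOREM in print (status: proved; unproved in the tree).
[cite: DecataldoMigliorini2002, Thm. 6.2.1 and Rem. 6.2.3 (§6.2)] [cite: Arapura2006, Thm. 7.4 (§7)] -/
def DecataldoMigliorini2002_hilbertScheme_isDominatedByPowers : Prop :=
  ∀ ⦃S H : SchemeOver ℂ⦄ (n : ℕ) (Ξ : (S ⊗ H).left.IdealSheafData), IsSmoothProjective 2 S →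
    IsHilbertSchemeOfPoints n S H Ξ → IsSmoothProjective (2 * n) H → IsDominatedByPowers (2 * n) H 2 S

end Facts

/-! ### Derived: the Hodge conjecture for Hilbert schemes of points from the powers of the surface -/

namespace Arapura2006_hodgeClasses_algebraic_of_isDominatedByPowers

variable {S H : SchemeOver ℂ} {n : ℕ} {Ξ : (S ⊗ H).left.IdealSheafData}

/-- **The Hodge conjecture for `S^{[n]}` and all its powers follows from the Hodge conjecture for all
powers of the smooth projective surface `S`** (Arapura 2006: Thm. 7.4 fed into Lemma 4.2 — the
inference printed as Cor. 7.6 for abelian surfaces), modulo the two records. [cite: Arapura2006, Lemma 4.2, Thm. 7.4 and Cor. 7.6] -/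
theorem hodgeConjectureFor_hilbertScheme_of_surfacePowers
    (h42 : Arapura2006_hodgeClasses_algebraic_of_isDominatedByPowers)
    (h74 : DecataldoMigliorini2002_hilbertScheme_isDominatedByPowers)
    (hS : IsSmoothProjective 2 S) (hH : IsHilbertSchemeOfPoints n S H Ξ)
    (hHs : IsSmoothProjective (2 * n) H)
    (hpow : ∀ m : ℕ, HodgeConjectureFor ((m + 1) * 2) (S.pow (m + 1))) :
    HodgeConjectureFor (2 * n) H ∧ ∀ m : ℕ, HodgeConjectureFor ((m + 1) * (2 * n)) (H.pow (m + 1)) :=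
  h42 hS hHs (h74 n Ξ hS hH hHs) hpow

/-- Same, from the Hodge conjecture for ALL cartesian powers `Sᵐ` stated with `m * 2` (the shape of
the summit-side target `HC_K3Powers`; the power `m = 0` is not used). [cite: Arapura2006, Lemma 4.2 and Thm. 7.4] -/
theorem hodgeConjectureFor_hilbertScheme_of_forall_pow
    (h42 : Arapura2006_hodgeClasses_algebraic_of_isDominatedByPowers)
    (h74 : DecataldoMigliorini2002_hilbertScheme_isDominatedByPowers)
    (hS : IsSmoothProjective 2 S) (hH : IsHilbertSchemeOfPoints n S H Ξ)
    (hHs : IsSmoothProjective (2 * n) H) (hpow : ∀ m : ℕ, HodgeConjectureFor (m * 2) (S.pow m)) :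
    HodgeConjectureFor (2 * n) H ∧ ∀ m : ℕ, HodgeConjectureFor ((m + 1) * (2 * n)) (H.pow (m + 1)) :=
  hodgeConjectureFor_hilbertScheme_of_surfacePowers h42 h74 hS hH hHs fun m ↦ hpow (m + 1)

/-- A variety dominated by the powers of `X`, where the Hodge conjecture is known for `X` itself and
for the powers `X^{m+2}`, satisfies the Hodge conjecture (the power `X¹ ≅ X` is fed through the left
unitor). [cite: Arapura2006, Lemma 4.2] -/
theorem hodgeConjectureFor_of_self_of_pow (h42 : Arapura2006_hodgeClasses_algebraic_of_isDominatedByPowers)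
    {dX dY : ℕ} {X Y : SchemeOver ℂ} (hX : IsSmoothProjective dX X) (hY : IsSmoothProjective dY Y)
    (hdom : IsDominatedByPowers dY Y dX X) (h1 : HodgeConjectureFor dX X)
    (hpow : ∀ m : ℕ, HodgeConjectureFor ((m + 2) * dX) (X.pow (m + 2))) : HodgeConjectureFor dY Y := by
  refine (h42 hX hY hdom fun m ↦ ?_).1
  cases m with
  | zero => simpa using (hodgeConjectureFor_pow_one_iff X).2 h1
  | succ m => exact hpow m

end Arapura2006_hodgeClasses_algebraic_of_isDominatedByPowers

end Literature.AlgebraicGeometry.HodgeTheory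

end
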